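import Mathlib
import Summits.Ventures.PercRepro2.TypedContract

/-!
# Typed-base reductions VII: inhabitants of the reducible class (blind cell PercRepro2,
night-3 g2, 2026-08-24)

Two families of typed instances with arbitrarily many typed edges that lie in `RedM`
(`TypedContract.lean`), hence satisfy row 2′TRI by `typedCount_nonneg_of_redM`:
* `redM_of_all_parallel` — all typed edges parallel (a bundle of any multiplicity; iterated
  rule (b));
* `redM_of_all_leaves` — every typed edge pendant at an unmarked leaf of the open graph (iterated
  rule (c′));
* `ZDelta_of_fractional_le_three` — the crux of record (ZΔ) with at most three fractional edges
  (the `|F| ≤ 3` rung of `ThreeTypedAll`, one application of `ZDelta_of_HCov`).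
-/

namespace Summit.Ventures.PercRepro2

namespace CovForm

namespace TypedRed

open OneTyped

/-! ## Two inhabitants of the class beyond three typed edges -/

section Examples

open Contract

variable {V : Type*} {E : Type*} [DecidableEq V] [Fintype E] [DecidableEq E]

omit [Fintype E] in
/-- **Any number of parallel typed edges** reduce: if all typed edges have the same ends, the
instance is in `RedM` for every pinning and typing (iterated rule (b)). -/
theorem redM_of_all_parallel (ends : E → Sym2 V) (o a₁ a₂ a₃ b : V) (F : Finset E)
    (hpar : ∀ e ∈ F, ∀ f ∈ F, ends e = ends f) (z : Config E) (τ : E → ℕ) :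
    RedM ends o a₁ a₂ a₃ b F z τ := by
  induction' hn : F.card using Nat.strong_induction_on with n ih generalizing F z τ
  by_cases h3 : F.card ≤ 3
  · exact RedM.base ends o a₁ a₂ a₃ b F z τ h3
  · -- two distinct typed edges exist
    have h1 : 1 < F.card := by omega
    obtain ⟨e, he, f, hf, hef⟩ := Finset.one_lt_card.1 h1
    have hsub : ∀ G : Finset E, G ⊆ F → ∀ e' ∈ G, ∀ f' ∈ G, ends e' = ends f' :=
      fun G hG e' he' f' hf' => hpar e' (hG he') f' (hG hf')
    have hc1 : (F.erase f).card < n := by rw [Finset.card_erase_of_mem hf]; omega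
    have hc2 : ((F.erase f).erase e).card < n := by
      rw [Finset.card_erase_of_mem (Finset.mem_erase.2 ⟨hef, he⟩), Finset.card_erase_of_mem hf]
      omega
    exact RedM.parallel ends o a₁ a₂ a₃ b F z τ hef (hpar e he f hf) he hf
      (ih _ hc1 _ (hsub _ (Finset.erase_subset f F)) _ _ rfl)
      (ih _ hc1 _ (hsub _ (Finset.erase_subset f F)) _ _ rfl)
      (ih _ hc2 _ (hsub _ ((Finset.erase_subset e _).trans (Finset.erase_subset f F))) _ _ rfl)

omit [Fintype E] in
/-- **Any number of typed pendant edges at unmarked leaves of the open graph** reduce: if every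
typed edge has an unmarked end all of whose other edges are pinned closed and untyped, the
instance is in `RedM` (iterated rule (c′)). -/
theorem redM_of_all_leaves (ends : E → Sym2 V) (o a₁ a₂ a₃ b : V) (F : Finset E) (z : Config E)
    (τ : E → ℕ)
    (hleaf : ∀ f ∈ F, ∃ l u : V, ends f = s(l, u) ∧ l ≠ u ∧ l ≠ o ∧ l ≠ a₁ ∧ l ≠ a₂ ∧ l ≠ a₃ ∧
      l ≠ b ∧ ∀ e', e' ≠ f → l ∈ ends e' → e' ∉ F ∧ z e' = false) :
    RedM ends o a₁ a₂ a₃ b F z τ := by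
  induction' hn : F.card using Nat.strong_induction_on with n ih generalizing F z
  by_cases h3 : F.card ≤ 3
  · exact RedM.base ends o a₁ a₂ a₃ b F z τ h3
  · have hne : F.Nonempty := Finset.card_pos.1 (by omega)
    obtain ⟨f, hf⟩ := hne
    obtain ⟨l, u, hfl, hlu, hlo, hl1, hl2, hl3, hlb, hcl⟩ := hleaf f hf
    have hc1 : (F.erase f).card < n := by rw [Finset.card_erase_of_mem hf]; omega
    refine RedM.leaf ends o a₁ a₂ a₃ b F z τ hfl hlu hlo hl1 hl2 hl3 hlb hf hcl
      (ih _ hc1 _ _ (fun f' hf' => ?_) rfl)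
    obtain ⟨l', u', hfl', hlu', hlo', hl1', hl2', hl3', hlb', hcl'⟩ :=
      hleaf f' (Finset.mem_of_mem_erase hf')
    refine ⟨l', u', hfl', hlu', hlo', hl1', hl2', hl3', hlb', fun e' he' hl'' => ?_⟩
    obtain ⟨hF, hz⟩ := hcl' e' he' hl''
    refine ⟨fun h => hF (Finset.mem_of_mem_erase h), ?_⟩
    by_cases hef : e' = f
    · subst hef; exact Function.update_self _ _ _
    · rw [Function.update_of_ne hef]; exact hz

end Examples

/-! ## The crux of record with at most three fractional edges -/

section ThreeFrac

variable {V : Type*} {E : Type*} [Fintype V] [DecidableEq V] [Fintype E] [DecidableEq E]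
  {R : Type*} [Field R] [LinearOrder R] [IsStrictOrderedRing R]

/-- **(ZΔ) with at most three fractional edges**: the crux of record for every labelled instance
whose weight vector has at most three edges of weight strictly between `0` and `1`
(`ThreeTypedAll.Gc_nonneg_of_fractional_le_three'` + `ZDelta_of_HCov`). -/
theorem ZDelta_of_fractional_le_three (ends : E → Sym2 V) (o a₁ a₂ a₃ b : V) (p : E → R)
    (hp : IsProbVec p) (hfrac : (Finset.univ.filter fun e => p e ≠ 0 ∧ p e ≠ 1).card ≤ 3)
    (hord : prob p (connEvent ends a₁ b) ≤ prob p (connEvent ends a₂ b)) :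
    ZDelta p ends o a₁ a₂ a₃ b :=
  ZDelta_of_HCov p hp ends hord
    (TwoTyped.Gc_nonneg_of_fractional_le_three' ends o a₁ a₂ a₃ b p hp hfrac)

end ThreeFrac

end TypedRed

end CovForm

end Summit.Ventures.PercRepro2
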